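import Mathlib
import Summits.BirchSwinnertonDyer.BirchSwinnertonDyer.Theorems.ManinLocalTwoThreeOddDegreeCuspZeroNonvanishing
import Literature.NumberTheory.EllipticCurves.LeadingTermPPartProofs
import Literature.NumberTheory.EllipticCurves.PAdicLFunctionDistributionProofs
import HarnessLib

/-!
# `N = 4p`: `12·L(E,1)/Ω⁺ ∈ ℤ` always, and `∉ 4ℤ` for an odd-degree parametrisation

Summit `BirchSwinnertonDyer`, sub-problem `BirchSwinnertonDyer`, route `ManinLocalTwoThree`; width seat `bsd-line-manin23-p2`
(gen 9), `--supports` the crux C2 `ManinOddAtFour` (stmt-BirchSwinnertonDyer-22967).  The seat's lattice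
statements at `N = 4p` (`p` an odd prime; every curve `W`, every datum `D`) — `6·{∞,0}_f ∈ Λ_f` (hexagon +
`three_mul_cuspZero_sub_quarter_mem`) and, for ODD modular degree, `3·{∞,0}_f ∉ Λ_f`
(`three_mul_cuspZeroSymbol_not_mem_of_odd_deg`, p659323) — are turned into
statements about the rational number `[0]⁺_f = L(W,1)/Ω⁺_f` (`ratPlusSymbol D.f 0`; `{∞,0}_f = [0]⁺_f·Ω⁺_f`,
`re Λ_f = ℤ·Ω⁺_f/2`, `Ω⁺_f ∈ Λ_f`):

* `ofReal_plusPeriod_mem_periodLattice` — `Ω⁺_f ∈ Λ_f` (any level; conjugation-stability of `Λ_f`);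
* `exists_re_eq_int_mul_half_plusPeriod` — `re z ∈ ℤ·Ω⁺_f/2` for `z ∈ Λ_f` (any level);
* `six_mul_cuspZeroSymbol_mem` — `6·{∞,0}_f ∈ Λ_f` at `N = 4p`;
* **`exists_twelve_mul_ratPlusSymbol_zero_eq`** — `12·[0]⁺_f ∈ ℤ` at `N = 4p` (every curve, every datum);
* **`ratPlusSymbol_zero_of_odd_deg`** — odd degree ⟹ `12·[0]⁺_f = k` with `4 ∤ k`; hence
  `not_exists_ratPlusSymbol_zero_eq_int_of_odd_deg`: `L(W,1)/Ω⁺_f ∉ ℤ` (its denominator is even: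
  `v₂([0]⁺_f) ∈ {−1,−2}`).

BSD is not proved by this; Manin's conjecture is not proved by this.
-/

set_option autoImplicit false
set_option linter.dupNamespace false

noncomputable section

open scoped MatrixGroups ModularForm
open CongruenceSubgroup
open Literature.NumberTheory.EllipticCurves Literature.NumberTheory.EllipticCurves.ModularForms

namespace Summit.BirchSwinnertonDyer.BirchSwinnertonDyer.Theorems.ManinLocalTwoThree

/-- `re z ∈ ℤ·(Ω⁺_f/2)` for every period `z ∈ Λ_f` of the newform of a datum (`re Λ_f = ℤ·Ω⁺_f/2`,
`Ω⁺_f > 0`). -/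
theorem exists_re_eq_int_mul_half_plusPeriod {W : WeierstrassCurve ℚ} {N : ℕ} [NeZero N]
    (D : ModularParametrizationData W N) {z : ℂ} (hz : z ∈ periodLattice D.f) :
    ∃ k : ℤ, z.re = k * (plusPeriod D.f / 2) := by
  have hpos : 0 < plusPeriod D.f := IsNewform0.plusPeriod_pos_holds D.isNewformOf.1 D.isNewformOf.coeffField_eq_bot
  have hmem : z.re ∈ realPeriods D.f := by
    rw [realPeriods, AddSubgroup.mem_map]
    exact ⟨z, hz, rfl⟩
  rw [realPeriods_eq_zmultiples_of_plusPeriod_pos D.f hpos, AddSubgroup.mem_zmultiples_iff] at hmem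
  obtain ⟨k, hk⟩ := hmem
  exact ⟨k, by rw [← hk, zsmul_eq_mul]⟩

/-- **`Ω⁺_f ∈ Λ_f`**: pick `z ∈ Λ_f` with `re z = Ω⁺_f/2`; `Λ_f` is conjugation-stable (rational newform),
and `z + z̄ = Ω⁺_f`. -/
theorem ofReal_plusPeriod_mem_periodLattice {W : WeierstrassCurve ℚ} {N : ℕ} [NeZero N]
    (D : ModularParametrizationData W N) :
    ((plusPeriod D.f : ℝ) : ℂ) ∈ periodLattice D.f := by
  have hpos : 0 < plusPeriod D.f := IsNewform0.plusPeriod_pos_holds D.isNewformOf.1 D.isNewformOf.coeffField_eq_bot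
  have hmem : plusPeriod D.f / 2 ∈ realPeriods D.f := by
    rw [realPeriods_eq_zmultiples_of_plusPeriod_pos D.f hpos]
    exact AddSubgroup.mem_zmultiples _
  rw [realPeriods, AddSubgroup.mem_map] at hmem
  obtain ⟨z, hz, hzre⟩ := hmem
  have hzre' : z.re = plusPeriod D.f / 2 := by simpa using hzre
  have hsum := (periodLattice D.f).add_mem hz
    (conj_mem_periodLattice_holds D.isNewformOf.1 D.isNewformOf.coeffField_eq_bot hz)
  convert hsum using 1
  rw [Complex.add_conj, hzre']
  push_cast
  ring

/-- `{∞,0}_f = [0]⁺_f · Ω⁺_f` (as a complex number) for the newform of a datum. -/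
theorem modularSymbol_zero_eq_ratPlusSymbol_mul_plusPeriod {W : WeierstrassCurve ℚ} [W.IsElliptic] {N : ℕ} [NeZero N]
    (D : ModularParametrizationData W N) :
    modularSymbol D.f 0 = ((((ratPlusSymbol D.f 0 : ℚ) : ℝ) * plusPeriod D.f : ℝ) : ℂ) := by
  rw [D.isNewformOf.modularSymbol_zero_eq_entireLFunction_one, D.isNewformOf.entireLFunction_one_eq]

/-- **`6·{∞,0}_f ∈ Λ_f` at `N = 4p`** (every curve, every datum): `2·(3{∞,0} − {∞,¼}) + 2{∞,¼}`. -/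
theorem six_mul_cuspZeroSymbol_mem {W : WeierstrassCurve ℚ} [W.IsElliptic] {p : ℕ} [NeZero (4 * p)]
    (hp : p.Prime) (hp2 : p ≠ 2) (D : ModularParametrizationData W (4 * p)) :
    (6 : ℂ) * modularSymbol D.f 0 ∈ periodLattice D.f := by
  obtain ⟨h2, -, -, -, -⟩ := fourPCuspHexagon_holds W D p hp hp2 rfl
  have := (periodLattice D.f).add_mem
    ((periodLattice D.f).nsmul_mem (three_mul_cuspZero_sub_quarter_mem hp hp2 D) 2) h2
  convert this using 1
  simp only [nsmul_eq_mul]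
  push_cast
  ring

/-- **`12·L(W,1)/Ω⁺_f ∈ ℤ` at `N = 4p`** (every curve, every datum; `p` an odd prime). -/
theorem exists_twelve_mul_ratPlusSymbol_zero_eq {W : WeierstrassCurve ℚ} [W.IsElliptic] {p : ℕ} [NeZero (4 * p)]
    (hp : p.Prime) (hp2 : p ≠ 2) (D : ModularParametrizationData W (4 * p)) :
    ∃ k : ℤ, 12 * ratPlusSymbol D.f 0 = k := by
  have hpos : 0 < plusPeriod D.f := IsNewform0.plusPeriod_pos_holds D.isNewformOf.1 D.isNewformOf.coeffField_eq_bot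
  have h6 : (((6 * (((ratPlusSymbol D.f 0 : ℚ) : ℝ) * plusPeriod D.f) : ℝ)) : ℂ) ∈ periodLattice D.f := by
    convert six_mul_cuspZeroSymbol_mem hp hp2 D using 1
    rw [modularSymbol_zero_eq_ratPlusSymbol_mul_plusPeriod D]
    push_cast
    ring
  obtain ⟨k, hk⟩ := exists_re_eq_int_mul_half_plusPeriod D h6
  rw [Complex.ofReal_re] at hk
  refine ⟨k, ?_⟩
  have hk' : (12 * ((ratPlusSymbol D.f 0 : ℚ) : ℝ)) * plusPeriod D.f = (k : ℝ) * plusPeriod D.f := by linarith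
  exact_mod_cast mul_right_cancel₀ hpos.ne' hk'

/-- **Odd degree at `N = 4p` ⟹ `3·[0]⁺_f ∉ ℤ`** (else `3{∞,0}_f = j·Ω⁺_f ∈ Λ_f`, against
`three_mul_cuspZeroSymbol_not_mem_of_odd_deg`). -/
theorem not_exists_three_mul_ratPlusSymbol_zero_eq_int_of_odd_deg {W : WeierstrassCurve ℚ} [W.IsElliptic] {p : ℕ}
    [NeZero (4 * p)] (hp : p.Prime) (hp2 : p ≠ 2) (D : ModularParametrizationData W (4 * p)) (hodd : Odd D.deg) :
    ¬ ∃ j : ℤ, 3 * ratPlusSymbol D.f 0 = j := by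
  rintro ⟨j, hj⟩
  apply three_mul_cuspZeroSymbol_not_mem_of_odd_deg hp hp2 D hodd
  have hj' : (((3 * ratPlusSymbol D.f 0 : ℚ) : ℝ) : ℂ) = (((j : ℚ) : ℝ) : ℂ) := by rw [hj]
  convert (periodLattice D.f).zsmul_mem (ofReal_plusPeriod_mem_periodLattice D) j using 1
  rw [modularSymbol_zero_eq_ratPlusSymbol_mul_plusPeriod D, zsmul_eq_mul]
  push_cast at hj' ⊢
  rw [← mul_assoc, hj']

/-- **Odd modular degree at `N = 4p` ⟹ `12·L(W,1)/Ω⁺_f = k ∈ ℤ` with `4 ∤ k`** (every curve, every datum; so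
`v₂(L(W,1)/Ω⁺_f) ∈ {−1, −2}` and `L(W,1) ≠ 0`). -/
theorem ratPlusSymbol_zero_of_odd_deg {W : WeierstrassCurve ℚ} [W.IsElliptic] {p : ℕ} [NeZero (4 * p)]
    (hp : p.Prime) (hp2 : p ≠ 2) (D : ModularParametrizationData W (4 * p)) (hodd : Odd D.deg) :
    ∃ k : ℤ, 12 * ratPlusSymbol D.f 0 = k ∧ ¬ (4 : ℤ) ∣ k := by
  obtain ⟨k, hk⟩ := exists_twelve_mul_ratPlusSymbol_zero_eq hp hp2 D
  refine ⟨k, hk, fun ⟨j, hj⟩ => not_exists_three_mul_ratPlusSymbol_zero_eq_int_of_odd_deg hp hp2 D hodd ⟨j, ?_⟩⟩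
  have : (12 : ℚ) * ratPlusSymbol D.f 0 = 4 * (j : ℚ) := by rw [hk, hj]; push_cast; ring
  linarith

/-- **Odd modular degree at `N = 4p` ⟹ `L(W,1)/Ω⁺_f ∉ ℤ`.** -/
theorem not_exists_ratPlusSymbol_zero_eq_int_of_odd_deg {W : WeierstrassCurve ℚ} [W.IsElliptic] {p : ℕ}
    [NeZero (4 * p)] (hp : p.Prime) (hp2 : p ≠ 2) (D : ModularParametrizationData W (4 * p)) (hodd : Odd D.deg) :
    ¬ ∃ j : ℤ, ratPlusSymbol D.f 0 = j := by
  rintro ⟨j, hj⟩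
  exact not_exists_three_mul_ratPlusSymbol_zero_eq_int_of_odd_deg hp hp2 D hodd ⟨3 * j, by rw [hj]; push_cast; ring⟩

end Summit.BirchSwinnertonDyer.BirchSwinnertonDyer.Theorems.ManinLocalTwoThree

end
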